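import Mathlib
import Summits.Ventures.PercRepro2.Defs
import Summits.Ventures.PercRepro2.Independence
import Summits.Ventures.PercRepro2.Harris

/-!
# The Ahlswede–Daykin bound for the three-event covariance inequality (blind cell PercRepro2, p4 g32;
proofs/P4-G32-STRUCTURE.md §7 and ADDENDUM 11: the AD lower bound, Theorem C)

The product weights are log-modular on the Boolean lattice `Config E` (**`weight_mul_weight_eq`**:
`w(ω)·w(ω′) = w(ω ⊓ ω′)·w(ω ⊔ ω′)`), so Mathlib's four functions theorem
(`four_functions_theorem_univ`) applies to indicator-weighted sums: for events `A, B, C, D` with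
`a ∈ A, b ∈ B ⟹ a ⊓ b ∈ C ∧ a ⊔ b ∈ D`, `P(A)·P(B) ≤ P(C)·P(D)` (**`prob_mul_prob_le_of_inf_sup`**).
For increasing `M ⊆ G` and `N := G ∖ M` this gives the pairing `(n ∈ N, h ∈ H) ↦ (n ⊓ h ∈ Mᶜ ∩ ↓N,
n ⊔ h ∈ H ∩ ↑N)`: **`prob_diff_mul_prob_le`** `P(N)·P(H) ≤ P(Mᶜ ∩ ↓N)·P(H ∩ ↑N)`, and the refined
**`prob_diff_mul_prob_diff_le`** `P(N)·P(H ∖ ↑N) ≤ P(Gᶜ ∩ ↓N)·P(H ∩ ↑N)`. Consequence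
(**`cov_inter_le_cov_of_cov_nonneg`**, Theorem C of the paper): for a decreasing `B` disjoint from
`N`, `Cov(M, B ∩ H) ≤ Cov(G, H)` holds whenever `Cov(M, H ∖ (B ∪ ↑N)) + P(H ∩ ↑N)·P(Gᶜ ∖ ↓N) ≥ 0`, in
particular whenever `H ∖ B ⊆ ↑N`. No instance, no notation.
-/

namespace Summit.Ventures.PercRepro2

namespace ThreeEvent

section LogModular

variable {E : Type*} [Fintype E] [DecidableEq E] {R : Type*} [CommRing R]

omit [Fintype E] [DecidableEq E] in
/-- The edge factor is log-modular on `Bool`. -/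
lemma edgeFactor_mul_edgeFactor (q : R) (a b : Bool) :
    edgeFactor q a * edgeFactor q b = edgeFactor q (a ⊓ b) * edgeFactor q (a ⊔ b) := by
  cases a <;> cases b <;> simp [edgeFactor, mul_comm]

omit [DecidableEq E] in
/-- **The product weights are log-modular**: `w(ω)·w(ω′) = w(ω ⊓ ω′)·w(ω ⊔ ω′)`. -/
lemma weight_mul_weight_eq (p : E → R) (ω ω' : Config E) :
    weight p ω * weight p ω' = weight p (ω ⊓ ω') * weight p (ω ⊔ ω') := by
  unfold weight
  rw [← Finset.prod_mul_distrib, ← Finset.prod_mul_distrib]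
  refine Finset.prod_congr rfl fun e _ => ?_
  exact edgeFactor_mul_edgeFactor (p e) (ω e) (ω' e)

end LogModular

section AD

variable {E : Type*} [Fintype E] [DecidableEq E] {R : Type*} [CommRing R] [LinearOrder R]
  [IsStrictOrderedRing R]

/-- **Ahlswede–Daykin for events**: if `a ∈ A, b ∈ B ⟹ a ⊓ b ∈ C ∧ a ⊔ b ∈ D`, then
`P(A)·P(B) ≤ P(C)·P(D)`. -/
theorem prob_mul_prob_le_of_inf_sup {p : E → R} (hp : IsProbVec p) {A B C D : Set (Config E)}
    (h : ∀ a ∈ A, ∀ b ∈ B, a ⊓ b ∈ C ∧ a ⊔ b ∈ D) :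
    prob p A * prob p B ≤ prob p C * prob p D := by
  classical
  have hw : ∀ ω, 0 ≤ weight p ω := weight_nonneg hp
  have key := four_functions_theorem_univ (A.indicator (weight p)) (B.indicator (weight p))
    (C.indicator (weight p)) (D.indicator (weight p))
    (fun ω => Set.indicator_nonneg (fun ω _ => hw ω) ω)
    (fun ω => Set.indicator_nonneg (fun ω _ => hw ω) ω)
    (fun ω => Set.indicator_nonneg (fun ω _ => hw ω) ω)
    (fun ω => Set.indicator_nonneg (fun ω _ => hw ω) ω) ?_
  · simpa only [prob] using key
  · intro a b
    by_cases ha : a ∈ A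
    · by_cases hb : b ∈ B
      · obtain ⟨hC, hD⟩ := h a ha b hb
        rw [Set.indicator_of_mem ha, Set.indicator_of_mem hb, Set.indicator_of_mem hC,
          Set.indicator_of_mem hD]
        exact le_of_eq (weight_mul_weight_eq p a b)
      · rw [Set.indicator_of_notMem hb, mul_zero]
        exact mul_nonneg (Set.indicator_nonneg (fun ω _ => hw ω) _)
          (Set.indicator_nonneg (fun ω _ => hw ω) _)
    · rw [Set.indicator_of_notMem ha, zero_mul]
      exact mul_nonneg (Set.indicator_nonneg (fun ω _ => hw ω) _)
        (Set.indicator_nonneg (fun ω _ => hw ω) _)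

/-- The up-closure `↑N = {ω ∣ ∃ n ∈ N, n ≤ ω}` as a set. -/
def upClosure (N : Set (Config E)) : Set (Config E) := {ω | ∃ n ∈ N, n ≤ ω}

/-- The down-closure `↓N = {ω ∣ ∃ n ∈ N, ω ≤ n}` as a set. -/
def downClosure (N : Set (Config E)) : Set (Config E) := {ω | ∃ n ∈ N, ω ≤ n}

omit [Fintype E] [DecidableEq E] [LinearOrder R] [IsStrictOrderedRing R] in
/-- `N ⊆ ↑N`. -/
lemma subset_upClosure (N : Set (Config E)) : N ⊆ upClosure N := fun ω h => ⟨ω, h, le_rfl⟩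

/-- **The AD pairing for `N = G ∖ M`**: for increasing `M ⊆ G` and increasing `H`,
`P(G ∖ M)·P(H) ≤ P(Mᶜ ∩ ↓(G ∖ M))·P(H ∩ ↑(G ∖ M))`. -/
theorem prob_diff_mul_prob_le {p : E → R} (hp : IsProbVec p) {G H M : Set (Config E)}
    (hM : IsUpperSet M) (hH : IsUpperSet H) :
    prob p (G \ M) * prob p H
      ≤ prob p (Mᶜ ∩ downClosure (G \ M)) * prob p (H ∩ upClosure (G \ M)) := by
  refine prob_mul_prob_le_of_inf_sup hp fun a ha b hb => ⟨⟨?_, a, ha, inf_le_left⟩, ?_, a, ha, le_sup_left⟩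
  · intro hab
    exact ha.2 (hM inf_le_left hab)
  · exact hH le_sup_right hb

/-- **The refined AD pairing**: `P(G ∖ M)·P(H ∖ ↑(G ∖ M)) ≤ P(Gᶜ ∩ ↓(G ∖ M))·P(H ∩ ↑(G ∖ M))`. -/
theorem prob_diff_mul_prob_diff_le {p : E → R} (hp : IsProbVec p) {G H M : Set (Config E)}
    (hM : IsUpperSet M) (hH : IsUpperSet H) :
    prob p (G \ M) * prob p (H \ upClosure (G \ M))
      ≤ prob p (Gᶜ ∩ downClosure (G \ M)) * prob p (H ∩ upClosure (G \ M)) := by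
  refine prob_mul_prob_le_of_inf_sup hp fun a ha b hb => ⟨⟨?_, a, ha, inf_le_left⟩, ?_, a, ha, le_sup_left⟩
  · -- `a ⊓ b ∉ G`: else `a ⊓ b ∈ G ∖ M` (it is below `a ∉ M`), so `b ∈ ↑(G ∖ M)`
    intro hab
    have hnotM : a ⊓ b ∉ M := fun h => ha.2 (hM inf_le_left h)
    exact hb.2 ⟨a ⊓ b, ⟨hab, hnotM⟩, inf_le_right⟩
  · exact hH le_sup_right hb.1

end AD

section Consequence

variable {E : Type*} [Fintype E] [DecidableEq E] {R : Type*} [CommRing R] [LinearOrder R]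
  [IsStrictOrderedRing R]

/-- **Theorem C (the AD bound)**: for increasing `G, H, M` with `M ⊆ G`, a decreasing `B` with
`B ∩ (G ∖ M) = ∅`, writing `N = G ∖ M`, `W = H ∩ ↑N`, `Λ = H ∖ (B ∪ ↑N)`:
`Cov(G, H) − Cov(M, B ∩ H) ≥ Cov(M, Λ) + P(W)·P(Gᶜ ∖ ↓N)`. -/
theorem cov_sub_cov_ge {p : E → R} (hp : IsProbVec p) {G H M B : Set (Config E)}
    (hG : IsUpperSet G) (hH : IsUpperSet H) (hM : IsUpperSet M) (hMG : M ⊆ G) (hB : IsLowerSet B)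
    (hNB : Disjoint (G \ M) B) :
    prob p (M ∩ (H \ (B ∪ upClosure (G \ M))))
        - prob p M * prob p (H \ (B ∪ upClosure (G \ M)))
        + prob p (H ∩ upClosure (G \ M)) * prob p (Gᶜ \ downClosure (G \ M))
      ≤ (prob p (G ∩ H) - prob p G * prob p H)
        - (prob p (M ∩ (B ∩ H)) - prob p M * prob p (B ∩ H)) := by
  classical
  -- the AD input, in the names used below
  have had := prob_diff_mul_prob_diff_le hp (G := G) (H := H) (M := M) hM hH
  set N := G \ M with hN
  set W := H ∩ upClosure N with hW
  set Λ := H \ (B ∪ upClosure N) with hΛ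
  -- set facts
  have hupN_sub_G : upClosure N ⊆ G := by
    rintro ω ⟨n, hn, hle⟩; exact hG hle hn.1
  have hupN_B : ∀ ω, ω ∈ upClosure N → ω ∉ B := by
    rintro ω ⟨n, hn, hle⟩ hωB
    exact Set.disjoint_left.1 hNB hn (hB hle hωB)
  -- P(H) = P(W) + P(H ∖ ↑N)
  have hH_split : prob p H = prob p W + prob p (H \ upClosure N) := by
    have := prob_inter_add_prob_inter_compl p H (upClosure N)
    rw [← this]; rfl
  -- P(H ∖ ↑N) = P(Λ) + P(B ∩ H)
  have hHN_split : prob p (H \ upClosure N) = prob p Λ + prob p (B ∩ H) := by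
    have h1 : H \ upClosure N = Λ ∪ (B ∩ H) := by
      ext ω
      constructor
      · rintro ⟨hωH, hωN⟩
        by_cases hωB : ω ∈ B
        · exact Or.inr ⟨hωB, hωH⟩
        · exact Or.inl ⟨hωH, fun h => h.elim hωB hωN⟩
      · rintro (⟨hωH, hωnot⟩ | ⟨hωB, hωH⟩)
        · exact ⟨hωH, fun h => hωnot (Or.inr h)⟩
        · exact ⟨hωH, fun h => hupN_B ω h hωB⟩
    have h2 : Disjoint Λ (B ∩ H) := by
      rw [Set.disjoint_left]
      rintro ω ⟨_, hωnot⟩ ⟨hωB, _⟩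
      exact hωnot (Or.inl hωB)
    rw [h1, prob_union_of_disjoint p h2]
  -- P(G ∩ H) = P(W) + P(M ∩ Λ) + P(M ∩ (B ∩ H))
  have hGH_split : prob p (G ∩ H) = prob p W + prob p (M ∩ Λ) + prob p (M ∩ (B ∩ H)) := by
    have h1 : G ∩ H = W ∪ (M ∩ Λ ∪ M ∩ (B ∩ H)) := by
      ext ω
      constructor
      · rintro ⟨hωG, hωH⟩
        by_cases hωN : ω ∈ upClosure N
        · exact Or.inl ⟨hωH, hωN⟩
        · have hωM : ω ∈ M := by
            by_contra hωM
            exact hωN ⟨ω, ⟨hωG, hωM⟩, le_rfl⟩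
          by_cases hωB : ω ∈ B
          · exact Or.inr (Or.inr ⟨hωM, hωB, hωH⟩)
          · exact Or.inr (Or.inl ⟨hωM, hωH, fun h => h.elim hωB hωN⟩)
      · rintro (⟨hωH, hωN⟩ | ⟨hωM, hωH, _⟩ | ⟨hωM, _, hωH⟩)
        · exact ⟨hupN_sub_G hωN, hωH⟩
        · exact ⟨hMG hωM, hωH⟩
        · exact ⟨hMG hωM, hωH⟩
    have hd1 : Disjoint (M ∩ Λ) (M ∩ (B ∩ H)) := by
      rw [Set.disjoint_left]
      rintro ω ⟨_, _, hωnot⟩ ⟨_, hωB, _⟩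
      exact hωnot (Or.inl hωB)
    have hd2 : Disjoint W (M ∩ Λ ∪ M ∩ (B ∩ H)) := by
      rw [Set.disjoint_left]
      rintro ω ⟨_, hωN⟩ (⟨_, _, hωnot⟩ | ⟨_, hωB, _⟩)
      · exact hωnot (Or.inr hωN)
      · exact hupN_B ω hωN hωB
    rw [h1, prob_union_of_disjoint p hd2, prob_union_of_disjoint p hd1]
    ring
  -- P(G) = P(M) + P(N)
  have hG_split : prob p G = prob p M + prob p N := by
    have h1 : G = M ∪ N := by
      ext ω
      constructor
      · intro h
        by_cases hm : ω ∈ M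
        · exact Or.inl hm
        · exact Or.inr ⟨h, hm⟩
      · rintro (h | ⟨h, _⟩)
        · exact hMG h
        · exact h
    have hd : Disjoint M N := by
      rw [Set.disjoint_left]; rintro ω hωM ⟨_, h⟩; exact h hωM
    rw [h1, prob_union_of_disjoint p hd]
  -- P(Gᶜ ∖ ↓N) = (1 − P(G)) − P(Gᶜ ∩ ↓N)
  have hGc_split : prob p (Gᶜ \ downClosure N) = (1 - prob p G) - prob p (Gᶜ ∩ downClosure N) := by
    have h1 := prob_inter_add_prob_inter_compl p Gᶜ (downClosure N)
    have h2 : Gᶜ \ downClosure N = Gᶜ ∩ (downClosure N)ᶜ := rfl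
    rw [h2, ← prob_compl p G]
    linarith
  -- assemble: after the splits the claim is exactly the AD input
  have hHp : prob p (H \ upClosure N) = prob p H - prob p W := by linarith
  rw [hHp] at had
  rw [hGc_split, hGH_split, hG_split, hH_split, hHN_split]
  rw [hH_split, hHN_split] at had
  linear_combination had

/-- **Theorem C**: `Cov(M, B ∩ H) ≤ Cov(G, H)` whenever the AD residual is nonnegative,
`0 ≤ Cov(M, H ∖ (B ∪ ↑N)) + P(H ∩ ↑N)·P(Gᶜ ∖ ↓N)` — in particular whenever `H ∖ B ⊆ ↑N`
(then `H ∖ (B ∪ ↑N) = ∅`). -/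
theorem cov_inter_le_cov_of_cov_nonneg {p : E → R} (hp : IsProbVec p) {G H M B : Set (Config E)}
    (hG : IsUpperSet G) (hH : IsUpperSet H) (hM : IsUpperSet M) (hMG : M ⊆ G) (hB : IsLowerSet B)
    (hNB : Disjoint (G \ M) B)
    (hres : 0 ≤ prob p (M ∩ (H \ (B ∪ upClosure (G \ M))))
        - prob p M * prob p (H \ (B ∪ upClosure (G \ M)))
        + prob p (H ∩ upClosure (G \ M)) * prob p (Gᶜ \ downClosure (G \ M))) :
    prob p (M ∩ (B ∩ H)) - prob p M * prob p (B ∩ H) ≤ prob p (G ∩ H) - prob p G * prob p H := by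
  have := cov_sub_cov_ge hp hG hH hM hMG hB hNB
  linarith

/-- **Theorem C, the clean case** `H ∖ B ⊆ ↑N`: `Cov(M, B ∩ H) ≤ Cov(G, H)`. -/
theorem cov_inter_le_cov_of_diff_subset {p : E → R} (hp : IsProbVec p) {G H M B : Set (Config E)}
    (hG : IsUpperSet G) (hH : IsUpperSet H) (hM : IsUpperSet M) (hMG : M ⊆ G) (hB : IsLowerSet B)
    (hNB : Disjoint (G \ M) B) (hsub : H \ B ⊆ upClosure (G \ M)) :
    prob p (M ∩ (B ∩ H)) - prob p M * prob p (B ∩ H) ≤ prob p (G ∩ H) - prob p G * prob p H := by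
  refine cov_inter_le_cov_of_cov_nonneg hp hG hH hM hMG hB hNB ?_
  have hΛ : H \ (B ∪ upClosure (G \ M)) = ∅ := by
    ext ω
    constructor
    · rintro ⟨hωH, hωnot⟩
      exact (hωnot (Or.inr (hsub ⟨hωH, fun h => hωnot (Or.inl h)⟩))).elim
    · intro h; exact h.elim
  rw [hΛ, Set.inter_empty]
  have h0 : prob p (∅ : Set (Config E)) = 0 := by unfold prob; simp
  rw [h0]
  have := mul_nonneg (prob_nonneg hp (H ∩ upClosure (G \ M))) (prob_nonneg hp (Gᶜ \ downClosure (G \ M)))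
  linarith

end Consequence

end ThreeEvent

end Summit.Ventures.PercRepro2
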